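import Summits.ABC.ABC.Theorems.TwistAmplificationSharpModerateLawLatticeArith
import Literature.NumberTheory.DiophantineGeometry.AbcHitCountUpperBoundProofs

/-!
# Lattice half of `SharpModerateLaw`, support file 4/4: the key modulus and the per-modulus bound

For `stub_latticeHalf` (crux stmt-ABC-1975, line `syzygy-lattice-half-deep-few-primes`): the key
modulus `keyM P₀ n = ∏_{v_p(n) ≥ 2 ∨ p ∈ P₀} p^{v_p(n)}` of a value `n = |F(q)|` (`P₀` = primes of
`|D| t`), its cofactor `uPart` (squarefree, prime to `P₀`) and depth carrier `vPart`
(`keyM_mul_uPart`, the radical budget `uPart_mul_vPart_mul_le`, `vPart_dvd_depthRad`), and the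
per-modulus count `perM_bound` / `latticeKey_main`: for a MAXIMAL form (`RingOfForm.memU_of_isMaximal`)
the primitive `q` in the shell with `M ∣ F(q)`, `|F(q)| ≤ m` number
`≤ 3^{ω(M)} (12288 m Y^{-1/6}/M + 6)`; plus the harmonic bound `sum_inv_Icc_le`.
-/

noncomputable section

namespace Summit.ABC.ABC.Theorems.SharpModerateLaw

open Literature.NumberTheory.CubicFields
open UniqueFactorizationMonoid
open Finset

/-! ## The key modulus `M(n)` and its arithmetic -/

section Key

variable (P₀ : Finset ℕ)

/-- The exponent-one primes of `n` outside `P₀`. -/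
def lowPart (n : ℕ) : Finset ℕ := n.primeFactors.filter fun p => n.factorization p = 1 ∧ p ∉ P₀

/-- The key modulus `M(n) = ∏_{v_p(n) ≥ 2 ∨ p ∈ P₀} p^{v_p(n)}`. -/
def keyM (n : ℕ) : ℕ :=
  ∏ p ∈ n.primeFactors.filter (fun p => ¬ (n.factorization p = 1 ∧ p ∉ P₀)), p ^ n.factorization p

/-- The cofactor `u(n) = n / M(n)`, a squarefree number prime to `P₀`. -/
def uPart (n : ℕ) : ℕ := ∏ p ∈ lowPart P₀ n, p

/-- `V(M) = ∏_{p ∣ M, p ∉ P₀} p`. -/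
def vPart (M : ℕ) : ℕ := ∏ p ∈ M.primeFactors.filter (fun p => p ∉ P₀), p

/-- `M(n) · u(n) = n`. -/
theorem keyM_mul_uPart {n : ℕ} (hn : n ≠ 0) : keyM P₀ n * uPart P₀ n = n := by
  have hu : uPart P₀ n = ∏ p ∈ n.primeFactors.filter (fun p => n.factorization p = 1 ∧ p ∉ P₀),
      p ^ n.factorization p := by
    refine Finset.prod_congr rfl fun p hp => ?_
    rw [(Finset.mem_filter.mp hp).2.1, pow_one]
  rw [hu, keyM, mul_comm, Finset.prod_filter_mul_prod_filter_not,
    ← Nat.prod_factorization_eq_prod_primeFactors, Nat.prod_factorization_pow_eq_self hn]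

/-- `M(n) ≥ 1`. -/
theorem keyM_pos (n : ℕ) : 0 < keyM P₀ n :=
  Finset.prod_pos fun _ hp => pow_pos (Nat.prime_of_mem_primeFactors (Finset.mem_filter.mp hp).1).pos _

/-- `V(M) ≥ 1`. -/
theorem vPart_pos (M : ℕ) : 0 < vPart P₀ M :=
  Finset.prod_pos fun _ hp => (Nat.prime_of_mem_primeFactors (Finset.mem_filter.mp hp).1).pos

/-- `u(n) ≥ 1`. -/
theorem uPart_pos (n : ℕ) : 0 < uPart P₀ n :=
  Finset.prod_pos fun _ hp => (Nat.prime_of_mem_primeFactors (Finset.mem_filter.mp hp).1).pos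

/-- The primes of `M(n)` are primes of `n` with `v_p(n) ≥ 2` or `p ∈ P₀`. -/
theorem mem_primeFactors_keyM {n p : ℕ} (hp : p ∈ (keyM P₀ n).primeFactors) :
    p ∈ n.primeFactors ∧ (n.factorization p = 1 → p ∈ P₀) := by
  have hpp := Nat.prime_of_mem_primeFactors hp
  have hdvd := Nat.dvd_of_mem_primeFactors hp
  rw [keyM, (Nat.Prime.prime hpp).dvd_finsetProd_iff] at hdvd
  obtain ⟨r, hr, hpr⟩ := hdvd
  obtain ⟨hr1, hr2⟩ := Finset.mem_filter.mp hr
  have : p = r := (Nat.prime_dvd_prime_iff_eq hpp (Nat.prime_of_mem_primeFactors hr1)).mp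
    (hpp.dvd_of_dvd_pow hpr)
  subst this
  exact ⟨hr1, fun h => by tauto⟩

/-- A prime of `M(n)` outside `P₀` divides `n` at least twice. -/
theorem sq_dvd_of_mem_primeFactors_keyM {n p : ℕ} (hn : n ≠ 0) (hp : p ∈ (keyM P₀ n).primeFactors)
    (hP : p ∉ P₀) : p ^ 2 ∣ n := by
  obtain ⟨h1, h2⟩ := mem_primeFactors_keyM P₀ hp
  have hpp := Nat.prime_of_mem_primeFactors h1
  have hpos := hpp.factorization_pos_of_dvd hn (Nat.dvd_of_mem_primeFactors h1)
  have hne : n.factorization p ≠ 1 := fun h => hP (h2 h)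
  exact (hpp.pow_dvd_iff_le_factorization hn).mpr (by omega)

/-- `pf(V(M)) = pf(M) ∖ P₀`. -/
theorem primeFactors_vPart (M : ℕ) :
    (vPart P₀ M).primeFactors = M.primeFactors.filter (fun p => p ∉ P₀) :=
  Nat.primeFactors_prod fun _ hp => Nat.prime_of_mem_primeFactors (Finset.mem_filter.mp hp).1

/-- `pf(M) ⊆ P₀ ∪ pf(V(M))`. -/
theorem primeFactors_subset_vPart (M : ℕ) : M.primeFactors ⊆ P₀ ∪ (vPart P₀ M).primeFactors := by
  intro p hp
  rw [primeFactors_vPart, Finset.mem_union, Finset.mem_filter]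
  tauto

/-- The radical budget: `u(n) · V(M(n)) · ∏_{P₀} p ≤ rad(N)` whenever `pf(n) ∪ P₀ ⊆ pf(N)`. -/
theorem uPart_mul_vPart_mul_le {n N : ℕ} (h1 : n.primeFactors ⊆ N.primeFactors)
    (h2 : P₀ ⊆ N.primeFactors) :
    uPart P₀ n * vPart P₀ (keyM P₀ n) * ∏ p ∈ P₀, p ≤ radical N := by
  classical
  set A := lowPart P₀ n
  set Bv := (keyM P₀ n).primeFactors.filter (fun p => p ∉ P₀)
  have hdAB : Disjoint A Bv := by
    rw [Finset.disjoint_left]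
    intro p hpA hpB
    obtain ⟨-, hfa, hPa⟩ := Finset.mem_filter.mp hpA
    obtain ⟨hpk, -⟩ := Finset.mem_filter.mp hpB
    exact hPa ((mem_primeFactors_keyM P₀ hpk).2 hfa)
  have hdP : Disjoint (A ∪ Bv) P₀ := by
    rw [Finset.disjoint_left]
    intro p hp hP
    rcases Finset.mem_union.mp hp with h | h
    · exact (Finset.mem_filter.mp h).2.2 hP
    · exact (Finset.mem_filter.mp h).2 hP
  have hsub : A ∪ Bv ∪ P₀ ⊆ N.primeFactors := by
    intro p hp
    rcases Finset.mem_union.mp hp with h | h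
    · rcases Finset.mem_union.mp h with h | h
      · exact h1 (Finset.mem_filter.mp h).1
      · exact h1 (mem_primeFactors_keyM P₀ (Finset.mem_filter.mp h).1).1
    · exact h2 h
  calc uPart P₀ n * vPart P₀ (keyM P₀ n) * ∏ p ∈ P₀, p = ∏ p ∈ A ∪ Bv ∪ P₀, p := by
        rw [Finset.prod_union hdP, Finset.prod_union hdAB]; rfl
    _ ≤ ∏ p ∈ N.primeFactors, p :=
        Finset.prod_le_prod_of_subset_of_one_le' hsub fun p hp _ => (Nat.prime_of_mem_primeFactors hp).one_le
    _ = radical N := Nat.radical_eq_prod_primeFactors.symm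

/-- `V(M(n)) ∣ depthRad n`: every prime dividing `n` twice divides `rad(n / rad n)`. -/
theorem vPart_dvd_depthRad {n : ℕ} (hn : n ≠ 0) : vPart P₀ (keyM P₀ n) ∣ depthRad n := by
  refine Finset.prod_primes_dvd _ (fun p hp => Nat.Prime.prime
    (Nat.prime_of_mem_primeFactors (Finset.mem_filter.mp hp).1)) fun p hp => ?_
  obtain ⟨hpk, hP⟩ := Finset.mem_filter.mp hp
  have hpp := Nat.prime_of_mem_primeFactors hpk
  have hsq := sq_dvd_of_mem_primeFactors_keyM P₀ hn hpk hP
  have hm0 : n / radical n ≠ 0 := by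
    intro h
    have := Nat.div_mul_cancel (radical_dvd_self (a := n))
    rw [h, zero_mul] at this; exact hn this.symm
  rw [depthRad, dvd_radical_iff_of_irreducible hpp hm0]
  -- `p² ∣ rad n · (n / rad n)` and `p² ∤ rad n`
  have hmul : p ^ 2 ∣ radical n * (n / radical n) := by rwa [Nat.mul_div_cancel' radical_dvd_self]
  by_contra hcon
  have hcop2 : Nat.Coprime (p ^ 2) (n / radical n) :=
    ((Nat.Prime.coprime_iff_not_dvd hpp).mpr hcon).pow_left 2
  have h2 : p ^ 2 ∣ radical n := hcop2.dvd_of_dvd_mul_right hmul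
  have hsqf := Nat.squarefree_iff_prime_squarefree.mp (squarefree_radical (a := n)) p hpp
  rw [pow_two] at h2
  exact hsqf h2

end Key

/-- **Per-modulus bound.** For `F` maximal, `M ≥ 1`, `m > 0`: the primitive `q` in the shell with
`M ∣ F(q)` and `|F(q)| ≤ m` are finitely many, at most `3^{ω(M)} (12288 m Y^{-1/6}/M + 6)`. -/
theorem perM_bound {F : BinaryCubic ℤ} (hmax : RingOfForm.IsMaximal F) (hD : F.disc ≠ 0) {Y m : ℝ}
    (hY : 0 < Y) (hm : 0 < m) {M : ℕ} (hM : 0 < M) :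
    {q : ℤ × ℤ | Int.gcd q.1 q.2 = 1 ∧ (M : ℤ) ∣ F.eval q.1 q.2 ∧ Y ≤ (Mplus F q : ℝ) ∧
        (Mplus F q : ℝ) < 2 * Y ∧ |(F.eval q.1 q.2 : ℝ)| ≤ m}.Finite ∧
      (({q : ℤ × ℤ | Int.gcd q.1 q.2 = 1 ∧ (M : ℤ) ∣ F.eval q.1 q.2 ∧ Y ≤ (Mplus F q : ℝ) ∧
        (Mplus F q : ℝ) < 2 * Y ∧ |(F.eval q.1 q.2 : ℝ)| ≤ m}.ncard : ℕ) : ℝ) ≤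
        3 ^ M.primeFactors.card * (12288 * m * Y ^ (-(1 / 6 : ℝ)) / M + 6) := by
  classical
  set W := {q : ℤ × ℤ | Int.gcd q.1 q.2 = 1 ∧ (M : ℤ) ∣ F.eval q.1 q.2 ∧ Y ≤ (Mplus F q : ℝ) ∧
        (Mplus F q : ℝ) < 2 * Y ∧ |(F.eval q.1 q.2 : ℝ)| ≤ m}
  have h1 := latticeShell_count F hD hY hm (q₀ := ((1 : ℤ), (0 : ℤ))) (by simp) Nat.one_pos
  have hWfin : W.Finite := h1.1.subset fun q hq => ⟨hq.1, by simp, hq.2.2⟩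
  refine ⟨hWfin, ?_⟩
  set T := hWfin.toFinset with hTdef
  set b : ℕ := ⌊12288 * m * Y ^ (-(1 / 6 : ℝ)) / M + 6⌋₊
  have hU : ∀ p ∈ M.primeFactors, F.MemU p := fun p hp =>
    RingOfForm.memU_of_isMaximal hmax (Nat.prime_of_mem_primeFactors hp).one_lt
  have hT : ∀ q ∈ T, Int.gcd q.1 q.2 = 1 ∧ (M : ℤ) ∣ F.eval q.1 q.2 := fun q hq => by
    rw [hTdef, Set.Finite.mem_toFinset] at hq; exact ⟨hq.1, hq.2.1⟩
  have hpos : 0 ≤ 12288 * m * Y ^ (-(1 / 6 : ℝ)) / M + 6 := by positivity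
  have hb : ∀ q₀ ∈ T, (T.filter (fun q => (M : ℤ) ∣ dt q₀ q)).card ≤ b := by
    intro q₀ hq₀
    have hq₀' := (Set.Finite.mem_toFinset hWfin).mp hq₀
    obtain ⟨hfin, hcard⟩ := latticeShell_count F hD hY hm hq₀'.1 hM
    have hsub : (↑(T.filter (fun q => (M : ℤ) ∣ dt q₀ q)) : Set (ℤ × ℤ)) ⊆
        {q : ℤ × ℤ | Int.gcd q.1 q.2 = 1 ∧ (M : ℤ) ∣ dt q₀ q ∧ Y ≤ (Mplus F q : ℝ) ∧
          (Mplus F q : ℝ) < 2 * Y ∧ |(F.eval q.1 q.2 : ℝ)| ≤ m} := by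
      intro q hq
      rw [Finset.mem_coe, Finset.mem_filter, hTdef, Set.Finite.mem_toFinset] at hq
      exact ⟨hq.1.1, hq.2, hq.1.2.2⟩
    refine Nat.le_floor ?_
    calc ((T.filter (fun q => (M : ℤ) ∣ dt q₀ q)).card : ℝ)
        = ((↑(T.filter (fun q => (M : ℤ) ∣ dt q₀ q)) : Set (ℤ × ℤ)).ncard : ℕ) := by
          rw [Set.ncard_coe_finset]
      _ ≤ _ := le_trans (by exact_mod_cast Set.ncard_le_ncard hsub hfin) hcard
  have hcardT := card_le_of_classes hM hU T hT b hb
  calc ((W.ncard : ℕ) : ℝ) = T.card := by rw [Set.ncard_eq_toFinset_card W hWfin]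
    _ ≤ (3 ^ M.primeFactors.card * b : ℕ) := by exact_mod_cast hcardT
    _ ≤ 3 ^ M.primeFactors.card * (12288 * m * Y ^ (-(1 / 6 : ℝ)) / M + 6) := by
        push_cast
        gcongr
        exact Nat.floor_le hpos

/-- `Σ_{s ≤ n} 1/s ≤ 1 + log n`. -/
theorem sum_inv_Icc_le (n : ℕ) : ∑ s ∈ Finset.Icc 1 n, (s : ℝ)⁻¹ ≤ 1 + Real.log n := by
  calc ∑ s ∈ Finset.Icc 1 n, (s : ℝ)⁻¹ = (harmonic n : ℝ) := by
        rw [harmonic_eq_sum_Icc]; push_cast; rfl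
    _ ≤ 1 + Real.log n := harmonic_le_one_add_log n

/-- **Registered export** (support file 4/4 of `stub_latticeHalf`): for a maximal form with `D ≠ 0`,
`M ≥ 1`, `m > 0`, the primitive `q` with `M ∣ F(q)`, `Y ≤ Mplus F q < 2Y`, `|F(q)| ≤ m` number at most
`3^{ω(M)} (12288 m Y^{-1/6}/M + 6)`. -/
theorem latticeKey_main : ∀ (F : BinaryCubic ℤ), RingOfForm.IsMaximal F → F.disc ≠ 0 → ∀ (Y m : ℝ), 0 < Y → 0 < m → ∀ (M : ℕ), 0 < M → (({q : ℤ × ℤ | Int.gcd q.1 q.2 = 1 ∧ (M : ℤ) ∣ F.eval q.1 q.2 ∧ Y ≤ (Mplus F q : ℝ) ∧ (Mplus F q : ℝ) < 2 * Y ∧ |(F.eval q.1 q.2 : ℝ)| ≤ m}.ncard : ℕ) : ℝ) ≤ 3 ^ M.primeFactors.card * (12288 * m * Y ^ (-(1 / 6 : ℝ)) / M + 6) :=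
  fun _ hmax hD _ _ hY hm _ hM => (perM_bound hmax hD hY hm hM).2

end Summit.ABC.ABC.Theorems.SharpModerateLaw

end
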